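import Summits.QuantumFields.YangMills.Theorems.BalabanUVNodesN15TwoSpacingGluingNeumannKnitEntryOne
import Summits.QuantumFields.YangMills.Theorems.BalabanUVNodesN15NeumannCubeDivergenceDefect
import HarnessLib

/-!
# THE GLUING STEP AT TWO LATTICE SPACINGS, XLVII: ENTRY 2 OF THE COVER's PARAMETRIX ON THE DOUBLED TORUS — `G₀∘∇*_ν` DECAYS, FROM dag-n15-a's SANDWICHED ENTRY-2 ROWS
# (dag-n15-c g13, FILE 89; N15 = NE2, s1 «background-layer OPERATOR ingredient»)

Cell `pub-ymgap`, seat `pub-ymgap-dag-n15-c` (R134 (a); HUMAN RULING D-0062), generation 13.  `bears_on: R4∕N15 · K3⁷ SpineGivenEndpointR13SepCoPH (stmt-QuantumFields-20544)`.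
Filed `--supports stmt-QuantumFields-20544 --as helper` — COUNT-NEUTRAL.  Theorems only (0 `def`, 0 `sorry`).  Imports BY NAME FILE 84 (through it FILE 83's cut-row editions, FILE 80 and
dag-n15-a's PROGRAMME N) and dag-n15-a N-IId∕N-IIg `…NeumannCubeDivergence(Defect)`; nothing in the tree is modified.

WHAT.  Doubled torus `M = MP (paramsOf d L (m+1) k hL)`, FILE 70's cover, the adjoint difference `E = ∇*_ν = fgradAdj n (bshiftEquiv ν)` (= `ρ(n•(s_ν⁻¹ − 1))`, FILE 4
`symbOp_sTinv_sub_one_eq`), Leibniz `M_h∘∇*_ν = ∇*_ν∘M_{h∘e_ν} + M_{∇_νh}` (FILE 1 `mulOp_comp_fgradAdj`):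
* §1 ★ `coverH_shift_support` (the shifted partition function `h_k∘e_ν` is supported one step inside the cube in direction `ν`: dag-n15-a's hypothesis `hg`), ★ `knitG_comp_divAdj_sandwich`
  (dag-n15-a N-IId `chiCube_neumannCubeG_comp_divAdj_mulOp` in FILE 83's shape: `M_χ∘G(□)∘∇*_ν∘M_{h∘e} = T₂∘M_{h∘e}`, `T₂ = M_χ∘Sym∘(G∇*_ν)∘M_χ` with `∇*_ν` as `fgradAdj`);
* §2 ★★★ **`hasMaj_parametrix_divAdj_knit`** — `∃ δ A > 0 ∀ m k r ν (k ≥ 1): G₀∘∇*_ν ≤ A·e^{−δ|y−y′|_T}` at the coarse spacing `L^k`: FILE 83 `hasMaj_parametrix_comp_cut` with the cut row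
  N-IIIb, the sandwiched rows N-IId `hasMaj_chiCube_symOp_gDivAdj_pair`, §1, FILE 84 `coverH_shift_cut` ∕ FILE 65 `fgrad_hcube_cut`, FILE 67's `|∇h| ≤ π∕w`, FILE 66's overlap.
The entry-2 `G₀∘E` row of FILE 50's `GluedLetters` for the glued `U ≡ 1` family; its two-grid defect (N-IIg's rate `(L^k)^{−1∕(8(d+1))}`) is the next file.

HONEST FRAMING ∕ LIMITS.  Block-majorant bookkeeping over LANDED rows at `U ≡ 1` on the doubled-cube torus MODEL; no new analytic estimate; nothing of [B5]∕[B6]∕[B9] asserted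
([B6] (2.133)–(2.136) p.247 shapes; [B9] (3.42) p.397 entry 2's shape).  NE2⁺ NOT PRINTED, NOT proved; N15 NOT discharged; counts of record UNMOVED (typed 28∕28 · discharged 5∕27);
one finite 𝕋⁴ at fixed ε per index — NOT infinite volume, NOT OS on ℝ⁴, NOT a mass gap, NOT Clay; R4 closes `BalabanLadder.UV` only.  Restate-immune (no Theses import).
-/

noncomputable section

namespace Summit.QuantumFields.YangMills.BalabanUVNodes.N15.Gluing

open Real
open Literature.MathematicalPhysics.QuantumFieldTheory.Balaban1983to89
open Literature.MathematicalPhysics.QuantumFieldTheory.Balaban1983to89.B5Prop11Plancherel (Tor fine unitVec)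
open Literature.MathematicalPhysics.QuantumFieldTheory.Balaban1983to89.B11SectG (BlockNorm HasMaj RowSum)
open Literature.MathematicalPhysics.QuantumFieldTheory.Balaban1983to89.B6Prop26Gluing (mulOp mulOp_apply ind ind_nonneg ind_le_one)
open Literature.MathematicalPhysics.QuantumFieldTheory.Balaban1983to89.B6UnitTorusCarrier (unitTorusGeo triangle254_unitTorusGeo rowSum_unitTorusGeo unitTorusGeo_dist_nonneg)
open Literature.MathematicalPhysics.QuantumFieldTheory.Balaban1983to89.B5SiteBridgeP12 (MP)
open Literature.MathematicalPhysics.QuantumFieldTheory.King1986.Torus (blockOf tdistT tdistT_nonneg)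
open Summit.QuantumFields.YangMills.BalabanUVNodes.N15.VectorPiece (bshiftEquiv bshiftEquiv_apply kingPrV blkFine)
open Summit.QuantumFields.YangMills.BalabanUVNodes.N15.BackgroundLayer (fgrad fgradAdj mulOp_comp_fgradAdj symbOp_sTinv_sub_one_eq)
open Summit.QuantumFields.YangMills.BalabanUVNodes.N15.TwoGrid (paramsOf gOp neumannCubeG symOp symbOp sTinv chiCube cubeBlocks ineq110_114_pair hasMaj_gOp_of_ineq
  hasMaj_chiCube_symOp_comp hasMaj_comp_mulOp_chiInt hasMaj_chiCube_symOp_gDivAdj_pair chiCube_neumannCubeG_comp_divAdj_mulOp)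

variable {d : ℕ}

/-! ## §1 The shifted partition function sits one step inside; the sandwiched identity in FILE 83's shape -/

section Support

variable {M : Fin (d + 1) → ℕ} [∀ μ, NeZero (M μ)] {w q m₀ S : ℕ} {n : ℕ} [NeZero n]

/-- ★ `h_k(e_ν b) ≠ 0 ⟹` the blocks of `b` and of `b + e_ν` lie in the cube (dag-n15-a N-IId's support hypothesis `hg` for `g = h_k ∘ e_ν`). [cite: Balaban1984PropagatorsII, (2.36) p.229 (supp h_□ ⊂ □: shape)] -/
theorem coverH_shift_support (hM : ∀ ν, M ν = 2 * q * w) (hw : 0 < w) (hfit : m₀ + 2 * w + 1 ≤ S) (hS : S ≤ 2 * q * w) (ν : Fin (d + 1)) (k : Fin (d + 1) → ZMod (2 * q))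
    (b : Tor (fine n M) × Fin (d + 1)) (hb : (hcube (2 * q) (coverXi M n w) k ∘ ⇑(bshiftEquiv M n ν)) b ≠ 0) :
    blockOf n M b.1 ∈ cubeBlocks M (coverCorner M w q m₀ k) S ∧ blockOf n M (b.1 + unitVec (fine n M) ν) ∈ cubeBlocks M (coverCorner M w q m₀ k) S := by
  have hχ := chiCube_coverCorner_eq_one_side (M := M) (n := n) (m₀ := m₀) hM hw hfit hS ν k
  have mem : ∀ x : Tor (fine n M) × Fin (d + 1), chiCube M n (coverCorner M w q m₀ k) S x = 1 → blockOf n M x.1 ∈ cubeBlocks M (coverCorner M w q m₀ k) S := fun x hx => by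
    unfold chiCube at hx
    by_contra hb'
    rw [if_neg hb'] at hx
    exact zero_ne_one hx
  refine ⟨mem b (chi_eq_one_of_hcube_ne_zero (2 * q) (coverXi M n w) (bshiftEquiv M n) ν hχ (Or.inr (Or.inl rfl)) hb), ?_⟩
  have h2 := mem (bshiftEquiv M n ν b) (chi_eq_one_of_hcube_ne_zero (2 * q) (coverXi M n w) (bshiftEquiv M n) ν hχ (Or.inl rfl) hb)
  rwa [bshiftEquiv_apply] at h2

/-- ★ **THE SANDWICHED ENTRY-2 IDENTITY IN FILE 83's SHAPE**: `M_{χ_□}∘G(□)∘∇*_ν∘M_{h_k∘e_ν} = T₂∘M_{h_k∘e_ν}`, `T₂ = M_{χ_□}∘Sym∘(G∘∇*_ν)∘M_{χ_□}` — dag-n15-a N-IId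
`chiCube_neumannCubeG_comp_divAdj_mulOp` on §1's support. [cite: Balaban1984PropagatorsII, (2.37) p.229, (2.136) p.247 (mechanism)] -/
theorem knitG_comp_divAdj_sandwich (hM : ∀ ν, M ν = 2 * q * w) (hM2 : ∀ ν, M ν = 2 * S) (hw : 0 < w) (hfit : m₀ + 2 * w + 1 ≤ S) (hS : S ≤ 2 * q * w) {a : ℝ} (ha : 0 < a)
    (ν : Fin (d + 1)) (k : Fin (d + 1) → ZMod (2 * q)) :
    mulOp (chiCube M n (coverCorner M w q m₀ k) S) ∘ₗ neumannCubeG M n (coverCorner M w q m₀ k) S a ∘ₗ fgradAdj (n : ℝ) (bshiftEquiv M n ν) ∘ₗ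
        mulOp (hcube (2 * q) (coverXi M n w) k ∘ ⇑(bshiftEquiv M n ν)) =
      (mulOp (chiCube M n (coverCorner M w q m₀ k) S) ∘ₗ symOp M n (coverCorner M w q m₀ k) ∘ₗ (gOp M n a ∘ₗ fgradAdj (n : ℝ) (bshiftEquiv M n ν)) ∘ₗ
        mulOp (chiCube M n (coverCorner M w q m₀ k) S)) ∘ₗ mulOp (hcube (2 * q) (coverXi M n w) k ∘ ⇑(bshiftEquiv M n ν)) := by
  have hn : 1 ≤ n := Nat.one_le_iff_ne_zero.mpr (NeZero.ne n)
  have h := chiCube_neumannCubeG_comp_divAdj_mulOp (c := coverCorner M w q m₀ k) (S := S) hM2 hn ha ν (fun b hb => coverH_shift_support hM hw hfit hS ν k b hb)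
  rw [symbOp_sTinv_sub_one_eq] at h
  refine LinearMap.ext fun f => ?_
  have hf := LinearMap.congr_fun h f
  simpa only [LinearMap.comp_apply] using hf

end Support

/-! ## §2 `G₀ ∘ ∇*_ν` decays -/

section OneGrid

variable {L : ℕ} [NeZero L]

/-- ★★★ **ENTRY 2 OF THE COVER's PARAMETRIX ON THE DOUBLED TORUS, COARSE MEMBER**: for odd `L ≥ 3`, `a > 0` there are `δ, A > 0` (uniform in `m, k, ν`) with `G₀∘∇*_ν ≤ A·e^{−δ|y−y′|_T}` at
the spacing `L^k`, `k ≥ 1` — FILE 83 `hasMaj_parametrix_comp_cut` with dag-n15-a's cut row and sandwiched entry-2 rows. [cite: Balaban1984PropagatorsII, (2.133), (2.136) p.247 (shapes +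
mechanism), (2.36)–(2.37) p.229; Balaban1985BackgroundPropagators, (3.42) p.397 (entry 2: shape); Balaban1984PropagatorsI, Prop. 1.2 (1.110) p.35] -/
theorem hasMaj_parametrix_divAdj_knit (hL : Odd L ∧ 1 < L) {a : ℝ} (ha : 0 < a) :
    ∃ δ A : ℝ, 0 < δ ∧ 0 < A ∧ ∀ (m kk : ℕ) (_hk : 1 ≤ kk) (ν : Fin (d + 1)),
      HasMaj (BlockNorm.ofBlocks (unitTorusGeo L kk (MP (paramsOf d L (m + 1) kk hL)))
          (fun b : Tor (fine (L ^ kk) (MP (paramsOf d L (m + 1) kk hL))) × Fin (d + 1) => blockOf (L ^ kk) (MP (paramsOf d L (m + 1) kk hL)) b.1))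
        (BlockNorm.ofBlocks (unitTorusGeo L kk (MP (paramsOf d L (m + 1) kk hL)))
          (fun b : Tor (fine (L ^ kk) (MP (paramsOf d L (m + 1) kk hL))) × Fin (d + 1) => blockOf (L ^ kk) (MP (paramsOf d L (m + 1) kk hL)) b.1))
        (parametrix (knitH d L m kk (L ^ kk) hL) (knitG d L m kk (L ^ kk) hL a) ∘ₗ fgradAdj ((L ^ kk : ℕ) : ℝ) (bshiftEquiv (MP (paramsOf d L (m + 1) kk hL)) (L ^ kk) ν))
        (fun y y' => A * Real.exp (-(δ * tdistT (MP (paramsOf d L (m + 1) kk hL)) y y'))) := by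
  have hL3 : 3 ≤ L := by obtain ⟨⟨j, hj⟩, h1⟩ := hL; omega
  have hLpos : 0 < L := by omega
  obtain ⟨δ₀, C, Cα, Cε, Cαε, hδ₀, hC, H⟩ := ineq110_114_pair (d := d) hL ha
  obtain ⟨δT, βT, hδT, hβT, HT⟩ := hasMaj_chiCube_symOp_gDivAdj_pair (d := d) hL ha
  set δ : ℝ := min δ₀ δT with hδ_def
  have hδ : 0 < δ := lt_min hδ₀ hδT
  set β : ℝ := 2 ^ (d + 1) * (C * Real.exp δ₀) with hβ_def
  have hβ : 0 ≤ β := by positivity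
  set Nov : ℝ := (((2 * L) ^ (d + 1) : ℕ) : ℝ) with hNov_def
  refine ⟨δ, Nov * (βT * 1 + β * π) + 1, hδ, by positivity, fun m kk hk ν => ?_⟩
  set M : Fin (d + 1) → ℕ := MP (paramsOf d L (m + 1) kk hL) with hMdef
  have hM : ∀ μ, M μ = 2 * L * L ^ m := MP_succ_eq L m kk hL
  have hM' : ∀ μ, M μ = 2 * (L * L ^ m) := fun μ => by rw [hM μ, mul_assoc]
  have hw : 0 < L ^ m := pow_pos hLpos m
  have hn : 1 ≤ L ^ kk := Nat.one_le_pow _ _ hLpos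
  have hfit := coverMargin_fit hL3 m
  have hfit1 : coverMargin L m + 2 * L ^ m + 1 ≤ L * L ^ m := by omega
  have hS : L * L ^ m ≤ 2 * L * L ^ m := by rw [mul_assoc]; omega
  have hSe : L ^ (m + 1) = L * L ^ m := by rw [pow_succ, mul_comm]
  have hwR : (1 : ℝ) ≤ ((L ^ m : ℕ) : ℝ) := by exact_mod_cast hw
  have hind : ∀ (k : Fin (d + 1) → ZMod (2 * L)) (y y' : Tor M),
      0 ≤ ind (g := unitTorusGeo L kk M) ((cubeBlocks M (coverCorner M (L ^ m) L (coverMargin L m) k) (L * L ^ m) : Finset (Tor M)) : Set (Tor M)) y *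
        ind (g := unitTorusGeo L kk M) ((cubeBlocks M (coverCorner M (L ^ m) L (coverMargin L m) k) (L * L ^ m) : Finset (Tor M)) : Set (Tor M)) y' :=
    fun k y y' => mul_nonneg (ind_nonneg _ _) (ind_nonneg _ _)
  -- the cut rows and the sandwiched entry-2 rows, rate weakened to `δ`
  have hG := hasMaj_gOp_of_ineq (L := L) (k := kk) M (L ^ kk) a hn (H (m + 1) kk 0 hk).1 hC.le
  have hGc : ∀ k : Fin (d + 1) → ZMod (2 * L),
      HasMaj (BlockNorm.ofBlocks (unitTorusGeo L kk M) (fun b : Tor (fine (L ^ kk) M) × Fin (d + 1) => blockOf (L ^ kk) M b.1))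
        (BlockNorm.ofBlocks (unitTorusGeo L kk M) (fun b : Tor (fine (L ^ kk) M) × Fin (d + 1) => blockOf (L ^ kk) M b.1))
        (mulOp (chiCube M (L ^ kk) (coverCorner M (L ^ m) L (coverMargin L m) k) (L * L ^ m)) ∘ₗ knitG d L m kk (L ^ kk) hL a k)
        (fun y y' => ind ((cubeBlocks M (coverCorner M (L ^ m) L (coverMargin L m) k) (L * L ^ m) : Finset (Tor M)) : Set (Tor M)) y *
          ind ((cubeBlocks M (coverCorner M (L ^ m) L (coverMargin L m) k) (L * L ^ m) : Finset (Tor M)) : Set (Tor M)) y' * (β * Real.exp (-(δ * tdistT M y y')))) := fun k =>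
    hasMaj_rate_le (hind k) hβ (min_le_left _ _)
      (hasMaj_chiCube_symOp_comp (L := L) (k := kk) (c := coverCorner M (L ^ m) L (coverMargin L m) k) (S := L * L ^ m) hC.le hδ₀.le hM'
        (hasMaj_comp_mulOp_chiInt (c := coverCorner M (L ^ m) L (coverMargin L m) k) (S := L * L ^ m) hC.le hG))
  have hT2 : ∀ k : Fin (d + 1) → ZMod (2 * L),
      HasMaj (BlockNorm.ofBlocks (unitTorusGeo L kk M) (fun b : Tor (fine (L ^ kk) M) × Fin (d + 1) => blockOf (L ^ kk) M b.1))
        (BlockNorm.ofBlocks (unitTorusGeo L kk M) (fun b : Tor (fine (L ^ kk) M) × Fin (d + 1) => blockOf (L ^ kk) M b.1))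
        (mulOp (chiCube M (L ^ kk) (coverCorner M (L ^ m) L (coverMargin L m) k) (L * L ^ m)) ∘ₗ symOp M (L ^ kk) (coverCorner M (L ^ m) L (coverMargin L m) k) ∘ₗ
          (gOp M (L ^ kk) a ∘ₗ fgradAdj ((L ^ kk : ℕ) : ℝ) (bshiftEquiv M (L ^ kk) ν)) ∘ₗ mulOp (chiCube M (L ^ kk) (coverCorner M (L ^ m) L (coverMargin L m) k) (L * L ^ m)))
        (fun y y' => ind ((cubeBlocks M (coverCorner M (L ^ m) L (coverMargin L m) k) (L * L ^ m) : Finset (Tor M)) : Set (Tor M)) y *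
          ind ((cubeBlocks M (coverCorner M (L ^ m) L (coverMargin L m) k) (L * L ^ m) : Finset (Tor M)) : Set (Tor M)) y' * (βT * Real.exp (-(δ * tdistT M y y')))) := fun k => by
    have h := (HT (m + 1) kk 0 hk (coverCorner M (L ^ m) L (coverMargin L m) k) ν).1
    rw [hSe, symbOp_sTinv_sub_one_eq] at h
    exact hasMaj_rate_le (hind k) hβT.le (min_le_right _ _) h
  -- the partition: Leibniz, cut, sandwiched identity, sizes, overlap
  have hχ := fun μ k => chiCube_coverCorner_eq_one_side (M := M) (n := L ^ kk) (m₀ := coverMargin L m) hM hw hfit1 hS μ k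
  have hleib : ∀ k : Fin (d + 1) → ZMod (2 * L), mulOp (knitH d L m kk (L ^ kk) hL k) ∘ₗ fgradAdj ((L ^ kk : ℕ) : ℝ) (bshiftEquiv M (L ^ kk) ν) =
      fgradAdj ((L ^ kk : ℕ) : ℝ) (bshiftEquiv M (L ^ kk) ν) ∘ₗ mulOp (knitH d L m kk (L ^ kk) hL k ∘ ⇑(bshiftEquiv M (L ^ kk) ν)) +
        mulOp (fgrad ((L ^ kk : ℕ) : ℝ) (bshiftEquiv M (L ^ kk) ν) (knitH d L m kk (L ^ kk) hL k)) := fun k => mulOp_comp_fgradAdj _ _ _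
  have hcut : ∀ k : Fin (d + 1) → ZMod (2 * L), mulOp (knitH d L m kk (L ^ kk) hL k) ∘ₗ mulOp (chiCube M (L ^ kk) (coverCorner M (L ^ m) L (coverMargin L m) k) (L * L ^ m)) =
      mulOp (knitH d L m kk (L ^ kk) hL k) := fun k => hcube_cut (2 * L) (coverXi M (L ^ kk) (L ^ m)) (bshiftEquiv M (L ^ kk)) 0 (hχ 0 k)
  have hE2 := fun k : Fin (d + 1) → ZMod (2 * L) => knitG_comp_divAdj_sandwich (n := L ^ kk) (m₀ := coverMargin L m) hM hM' hw hfit1 hS ha ν k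
  have hh : ∀ (k : Fin (d + 1) → ZMod (2 * L)) x, |knitH d L m kk (L ^ kk) hL k x| ≤ 1 := fun k x => abs_coverH_le_one k x
  have hhs : ∀ (k : Fin (d + 1) → ZMod (2 * L)) x, |(knitH d L m kk (L ^ kk) hL k ∘ ⇑(bshiftEquiv M (L ^ kk) ν)) x| ≤ 1 := fun k x => abs_coverH_le_one k (bshiftEquiv M (L ^ kk) ν x)
  have hdh : ∀ (k : Fin (d + 1) → ZMod (2 * L)) x, |fgrad ((L ^ kk : ℕ) : ℝ) (bshiftEquiv M (L ^ kk) ν) (knitH d L m kk (L ^ kk) hL k) x| ≤ π / ((L ^ m : ℕ) : ℝ) :=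
    fun k x => abs_fgrad_coverH_le hM hw k ν x
  have hN := fun y => sum_ind_cubeBlocks_le (M := M) (w := L ^ m) (q := L) (m₀ := coverMargin L m) L kk y
  -- FILE 83
  have key := hasMaj_parametrix_comp_cut (g := unitTorusGeo L kk M) (fun b : Tor (fine (L ^ kk) M) × Fin (d + 1) => blockOf (L ^ kk) M b.1)
    (fun k => ((cubeBlocks M (coverCorner M (L ^ m) L (coverMargin L m) k) (L * L ^ m) : Finset (Tor M)) : Set (Tor M))) (E := fgradAdj ((L ^ kk : ℕ) : ℝ) (bshiftEquiv M (L ^ kk) ν))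
    (G := knitG d L m kk (L ^ kk) hL a) hβ hβT.le zero_le_one (by positivity : (0 : ℝ) ≤ π / ((L ^ m : ℕ) : ℝ)) hleib hcut hE2 hh hhs hdh hN hGc hT2
  refine key.mono fun y y' => mul_le_mul_of_nonneg_right ?_ (Real.exp_nonneg _)
  have hπw : β * (π / ((L ^ m : ℕ) : ℝ)) ≤ β * π := mul_le_mul_of_nonneg_left (div_le_self Real.pi_pos.le hwR) hβ
  have h2 : Nov * (βT * 1 + β * (π / ((L ^ m : ℕ) : ℝ))) ≤ Nov * (βT * 1 + β * π) := mul_le_mul_of_nonneg_left (by linarith) (by positivity)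
  linarith

end OneGrid

end Summit.QuantumFields.YangMills.BalabanUVNodes.N15.Gluing

end
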